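import Summits.QuantumFields.BalabanUV.T4Continuum.Support.VariationalColourInterpolant
import Summits.QuantumFields.BalabanUV.T4Continuum.Support.VariationalVectorGaugeSlice

/-!
# T⁴ programme, spine node NE2 (U1a), lane P2 — THE SHARP `ℓ²` SIZE OF THE CENTRED ONE-STEP INTERPOLANT: coefficient ONE on the mass term
# (item «V-ONE-G WITH BACKGROUND», file 3a; model level; cell `pub-balaban`)

NE2 formalisation swarm `b2b-balaban-t4-ne2-formalise-*`, leaf prover 01 GEN 8 (`prover-b2b-balaban-t4-ne2-formalise-leaf-01-g8-0`); journal INTENT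
CLAIMS.log 2026-08-20 l.18200.  On top of leaf-02-g4's `VariationalColourInterpolant` (p215238: `Phiv`, `interpv`, `interpv_bpt`, `norm_star_apply_le`) and
the road's weights `VariationalCovariantWeights` (`wt`, `abs_wt_le`, `sum_wt_coord`) BY NAME.

WHAT.  **`nsqv_interpv_le_sharp`**: `Σ_x‖(interpv T′ Rc v)(x)‖² ≤ L^d·Σ_y‖v y‖² + (d∕4)·L^d·Σ_{y,μ}‖(D_μ v)(y)‖²` for unitary one-step site operators —
coefficient ONE on the mass (per block `Σ_j‖v + Σ_μ w(j_μ)•D_μv‖² = L^d‖v‖² + Σ_j‖Σ_μ w(j_μ)•D_μv‖²`, the cross term vanishing because the centred weights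
have `Σ_j w(j_μ) = 0`; `|w| ≤ ½` and Cauchy–Schwarz for the rest).  leaf-02-g4's `sum_norm_sq_PhiFv_le` (`≤ 2(1+d²)L^dΣ‖v‖²`) bounds the derivative by the
mass and would put a factor `2(1+d²)` in front of the coarse gauge functional in V-ONE-G (file 3b `VariationalVectorOneG`); the sharp form puts the excess
into a decaying derivative term.  Also `interpv_sub` (additivity in the field) and the square-root reading `norm_toLp_interpv_le`.

HONEST FRAMING (T4-DAG p. 1).  Lattice bookkeeping at MODEL level (site operators ∕ bond operators DATA, c5); [folklore]; nothing printed is a hypothesis;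
no `def`, no `def … : Prop`, no `sorry`; axioms standard.  NE2 NOT proved; spine PROVED 0∕9 unchanged; rung (B)+1 on a fixed finite T⁴ — NOT infinite volume,
NOT mass gap, NOT Clay.  HONEST DEPENDENCY (cell, verbatim): continuum YM on T⁴ ⇐ BetaPertH ∧ nine spine estimates (0/9 proved); BetaPertH ⇐ (D1) ∧ (D4) ∧
CAP+tail; G-an2-4 gates asym, D1 and NE2/3/4.
-/

noncomputable section

namespace Summit.QuantumFields.BalabanUV.T4Continuum.VariationalInterpolantSharp

open Finset WithLp
open scoped InnerProductSpace
open Literature.MathematicalPhysics.QuantumFieldTheory.Balaban1983to89.B5Prop11Plancherel (Tor fine unitVec)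
open Literature.MathematicalPhysics.QuantumFieldTheory.Balaban1983to89.B5Block118 (bpt)
open Literature.MathematicalPhysics.QuantumFieldTheory.Balaban1983to89.B5AverageCurlStokes (sum_blocks_real)
open Summit.QuantumFields.BalabanUV.T4Continuum.VariationalColourFederbush (cDv)
open Summit.QuantumFields.BalabanUV.T4Continuum.VariationalCovariantWeights (wt abs_wt_le sum_wt_coord)
open Summit.QuantumFields.BalabanUV.T4Continuum.VariationalColourInterpolant (Phiv PhiFv interpv interpv_bpt norm_star_apply_le)
open Summit.QuantumFields.BalabanUV.T4Continuum.VariationalVectorGaugeSlice (norm_toLp_sq)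

variable {d : ℕ} {E : Type*} [NormedAddCommGroup E] [InnerProductSpace ℂ E] [CompleteSpace E]

/-! ## §1 The sharp size of the centred one-step interpolant -/

section Size

variable (L : ℕ) [NeZero L] (N : Fin d → ℕ) [∀ μ, NeZero (N μ)]

omit [CompleteSpace E] [NeZero L] [∀ μ, NeZero (N μ)] in
/-- per block: `Σ_j ‖Φ(y,j)‖² = L^d‖v y‖² + Σ_j‖Σ_μ w(j_μ)•D_μv(y)‖²` — the cross term `2Re⟪v y, Σ_j Σ_μ w(j_μ)•D_μ v⟫` VANISHES (`Σ_j w(j_μ) = 0`). [folklore] -/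
theorem sum_norm_sq_Phiv_eq (Rc : Tor N → Fin d → (E →L[ℂ] E)) (v : Tor N → E) (y : Tor N) :
    ∑ j : Fin d → Fin L, ‖Phiv L N Rc v y j‖ ^ 2
      = (L : ℝ) ^ d * ‖v y‖ ^ 2 + ∑ j : Fin d → Fin L, ‖∑ μ, ((wt L (j μ) : ℝ) : ℂ) • cDv N Rc v y μ‖ ^ 2 := by
  have hcardR : (Fintype.card (Fin d → Fin L) : ℝ) = (L : ℝ) ^ d := by
    rw [Fintype.card_fun, Fintype.card_fin, Fintype.card_fin]; push_cast; ring
  have hexp : ∀ j : Fin d → Fin L, ‖Phiv L N Rc v y j‖ ^ 2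
      = ‖v y‖ ^ 2 + 2 * RCLike.re ⟪v y, ∑ μ, ((wt L (j μ) : ℝ) : ℂ) • cDv N Rc v y μ⟫_ℂ + ‖∑ μ, ((wt L (j μ) : ℝ) : ℂ) • cDv N Rc v y μ‖ ^ 2 := by
    intro j
    unfold Phiv
    rw [← @norm_add_sq ℂ]
  rw [Finset.sum_congr rfl fun j _ => hexp j, Finset.sum_add_distrib, Finset.sum_add_distrib, Finset.sum_const, Finset.card_univ, nsmul_eq_mul,
    hcardR]
  -- the cross term: `Σ_j ⟪v y, Σ_μ w(j_μ)•D_μ v⟫ = ⟪v y, Σ_μ (Σ_j w(j_μ))•D_μ v⟫ = 0`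
  have hcross : ∑ j : Fin d → Fin L, 2 * RCLike.re ⟪v y, ∑ μ, ((wt L (j μ) : ℝ) : ℂ) • cDv N Rc v y μ⟫_ℂ = 0 := by
    rw [← Finset.mul_sum, ← map_sum, ← inner_sum]
    have hz : ∑ j : Fin d → Fin L, ∑ μ, ((wt L (j μ) : ℝ) : ℂ) • cDv N Rc v y μ = 0 := by
      rw [Finset.sum_comm]
      refine Finset.sum_eq_zero fun μ _ => ?_
      rw [← Finset.sum_smul]
      have h0 : ∑ j : Fin d → Fin L, ((wt L (j μ) : ℝ) : ℂ) = 0 := by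
        rw [← Complex.ofReal_sum]  -- needs the sum pushed inside the coercion
        · rw [sum_wt_coord L μ, Complex.ofReal_zero]
      rw [h0, zero_smul]
    rw [hz, inner_zero_right, map_zero, mul_zero]
  rw [hcross, add_zero]

omit [CompleteSpace E] [NeZero L] [∀ μ, NeZero (N μ)] in
/-- the derivative part per offset: `‖Σ_μ w(j_μ)•D_μ v(y)‖² ≤ (d∕4)·Σ_μ‖D_μ v(y)‖²` (`|w| ≤ ½`, Cauchy–Schwarz). [folklore] -/
theorem norm_sq_sum_wt_smul_le (Rc : Tor N → Fin d → (E →L[ℂ] E)) (v : Tor N → E) (y : Tor N) (j : Fin d → Fin L) :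
    ‖∑ μ, ((wt L (j μ) : ℝ) : ℂ) • cDv N Rc v y μ‖ ^ 2 ≤ (d : ℝ) / 4 * ∑ μ, ‖cDv N Rc v y μ‖ ^ 2 := by
  have h1 : ‖∑ μ, ((wt L (j μ) : ℝ) : ℂ) • cDv N Rc v y μ‖ ≤ ∑ μ, (1 / 2) * ‖cDv N Rc v y μ‖ := by
    refine (norm_sum_le _ _).trans (Finset.sum_le_sum fun μ _ => ?_)
    rw [norm_smul, Complex.norm_real, Real.norm_eq_abs]
    exact mul_le_mul_of_nonneg_right (abs_wt_le L (j μ).is_lt) (norm_nonneg _)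
  have h2 := pow_le_pow_left₀ (norm_nonneg _) h1 2
  have hcs := VariationalCovariantFederbush.sq_sum_le_card_mul (Finset.univ : Finset (Fin d)) (fun μ => (1 / 2 : ℝ) * ‖cDv N Rc v y μ‖)
  rw [Finset.card_univ, Fintype.card_fin] at hcs
  have e : ∑ μ, ((1 / 2 : ℝ) * ‖cDv N Rc v y μ‖) ^ 2 = (1 / 4) * ∑ μ, ‖cDv N Rc v y μ‖ ^ 2 := by
    rw [Finset.mul_sum]; exact Finset.sum_congr rfl fun μ _ => by ring
  rw [e] at hcs
  calc _ ≤ (∑ μ, (1 / 2 : ℝ) * ‖cDv N Rc v y μ‖) ^ 2 := h2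
    _ ≤ d * ((1 / 4) * ∑ μ, ‖cDv N Rc v y μ‖ ^ 2) := hcs
    _ = _ := by ring

/-- **THE SHARP SIZE OF THE CENTRED INTERPOLANT** (unitary one-step site operators): `Σ_x‖(interpv T′ Rc v)(x)‖² ≤ L^d·Σ_y‖v y‖² + (d∕4)·L^d·Σ_y Σ_μ‖(D_μv)(y)‖²`
— coefficient one on the mass term. [folklore] -/
theorem nsqv_interpv_le_sharp {T' : Tor (fine L N) → (E →L[ℂ] E)} (hT' : ∀ x, T' x ∈ unitary (E →L[ℂ] E)) (Rc : Tor N → Fin d → (E →L[ℂ] E))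
    (v : Tor N → E) :
    ∑ x, ‖interpv L N T' Rc v x‖ ^ 2 ≤ (L : ℝ) ^ d * ∑ y, ‖v y‖ ^ 2 + (d : ℝ) / 4 * ((L : ℝ) ^ d * ∑ y, ∑ μ, ‖cDv N Rc v y μ‖ ^ 2) := by
  have hcardR : (Fintype.card (Fin d → Fin L) : ℝ) = (L : ℝ) ^ d := by
    rw [Fintype.card_fun, Fintype.card_fin, Fintype.card_fin]; push_cast; ring
  rw [sum_blocks_real L N (fun x => ‖interpv L N T' Rc v x‖ ^ 2)]
  simp only [interpv_bpt]
  calc ∑ y : Tor N, ∑ j : Fin d → Fin L, ‖star (T' (bpt L N y j)) (Phiv L N Rc v y j)‖ ^ 2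
      ≤ ∑ y : Tor N, ∑ j : Fin d → Fin L, ‖Phiv L N Rc v y j‖ ^ 2 :=
        Finset.sum_le_sum fun y _ => Finset.sum_le_sum fun j _ => pow_le_pow_left₀ (norm_nonneg _) (norm_star_apply_le (hT' _) _) 2
    _ ≤ ∑ y : Tor N, ((L : ℝ) ^ d * ‖v y‖ ^ 2 + (Fintype.card (Fin d → Fin L) : ℝ) * ((d : ℝ) / 4 * ∑ μ, ‖cDv N Rc v y μ‖ ^ 2)) := by
        refine Finset.sum_le_sum fun y _ => ?_
        rw [sum_norm_sq_Phiv_eq]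
        refine add_le_add le_rfl ?_
        calc ∑ j : Fin d → Fin L, ‖∑ μ, ((wt L (j μ) : ℝ) : ℂ) • cDv N Rc v y μ‖ ^ 2
            ≤ ∑ _j : Fin d → Fin L, (d : ℝ) / 4 * ∑ μ, ‖cDv N Rc v y μ‖ ^ 2 := Finset.sum_le_sum fun j _ => norm_sq_sum_wt_smul_le L N Rc v y j
          _ = _ := by rw [Finset.sum_const, Finset.card_univ, nsmul_eq_mul]
    _ = _ := by rw [Finset.sum_add_distrib, ← Finset.mul_sum, ← Finset.mul_sum, hcardR, ← Finset.mul_sum]; ring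


/-- the interpolant is additive in the coarse field (every ingredient is linear). [folklore] -/
theorem interpv_sub (T' : Tor (fine L N) → (E →L[ℂ] E)) (Rc : Tor N → Fin d → (E →L[ℂ] E)) (a b : Tor N → E) :
    interpv L N T' Rc (a - b) = interpv L N T' Rc a - interpv L N T' Rc b := by
  funext x
  have h : PhiFv L N Rc (a - b) x = PhiFv L N Rc a x - PhiFv L N Rc b x := by
    simp only [PhiFv, Phiv, cDv, Pi.sub_apply, map_sub, smul_sub, Finset.sum_sub_distrib]
    abel
  simp only [interpv, h, map_sub, Pi.sub_apply]

/-- the sharp size in square-root form: `‖toLp(J₀ v)‖ ≤ √(L^d)·(√(Σ‖v‖²) + (√d∕2)·√(Σ_{y,μ}‖D_μ v‖²))`. [folklore] -/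
theorem norm_toLp_interpv_le {T' : Tor (fine L N) → (E →L[ℂ] E)} (hT' : ∀ x, T' x ∈ unitary (E →L[ℂ] E)) (Rc : Tor N → Fin d → (E →L[ℂ] E))
    (v : Tor N → E) :
    ‖toLp 2 (interpv L N T' Rc v)‖ ≤ Real.sqrt ((L : ℝ) ^ d) * (Real.sqrt (∑ y, ‖v y‖ ^ 2)
      + Real.sqrt ((d : ℝ) / 4) * Real.sqrt (∑ y, ∑ μ, ‖cDv N Rc v y μ‖ ^ 2)) := by
  have hLd : (0 : ℝ) ≤ (L : ℝ) ^ d := by positivity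
  have hA : 0 ≤ ∑ y, ‖v y‖ ^ 2 := Finset.sum_nonneg fun _ _ => by positivity
  have hB : 0 ≤ ∑ y, ∑ μ, ‖cDv N Rc v y μ‖ ^ 2 := Finset.sum_nonneg fun _ _ => Finset.sum_nonneg fun _ _ => by positivity
  have h := nsqv_interpv_le_sharp L N hT' Rc v
  rw [← norm_toLp_sq (fine L N)] at h
  have hrhs : (L : ℝ) ^ d * ∑ y, ‖v y‖ ^ 2 + (d : ℝ) / 4 * ((L : ℝ) ^ d * ∑ y, ∑ μ, ‖cDv N Rc v y μ‖ ^ 2)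
      ≤ (Real.sqrt ((L : ℝ) ^ d) * (Real.sqrt (∑ y, ‖v y‖ ^ 2) + Real.sqrt ((d : ℝ) / 4) * Real.sqrt (∑ y, ∑ μ, ‖cDv N Rc v y μ‖ ^ 2))) ^ 2 := by
    rw [mul_pow, Real.sq_sqrt hLd, add_sq, Real.sq_sqrt hA, mul_pow, Real.sq_sqrt (by positivity), Real.sq_sqrt hB]
    have : 0 ≤ Real.sqrt (∑ y, ‖v y‖ ^ 2) * (Real.sqrt ((d : ℝ) / 4) * Real.sqrt (∑ y, ∑ μ, ‖cDv N Rc v y μ‖ ^ 2)) := by positivity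
    nlinarith
  have h0 : 0 ≤ Real.sqrt ((L : ℝ) ^ d) * (Real.sqrt (∑ y, ‖v y‖ ^ 2) + Real.sqrt ((d : ℝ) / 4) * Real.sqrt (∑ y, ∑ μ, ‖cDv N Rc v y μ‖ ^ 2)) := by
    positivity
  exact (pow_le_pow_iff_left₀ (norm_nonneg _) h0 two_ne_zero).mp (h.trans hrhs)

end Size

end Summit.QuantumFields.BalabanUV.T4Continuum.VariationalInterpolantSharp

end
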